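import Mathlib
import Summits.CriticalPhenomena.SAWScalingLimit.Theses.SAWDevelopingMap
import Summits.CriticalPhenomena.SAWScalingLimit.Theorems.NoFoldBound.Negative.BoundaryRayRows

/-!
# `NoFoldBound` / `SourceLoopBound`, negative side: the Duminil-Copin–Smirnov boundary identities admit an unbounded nonnegative solution

Crux `NoFoldBound` (stmt-CriticalPhenomena-8296; its source-vertex stratum is the support item
`SourceLoopBound`, stmt-CriticalPhenomena-8300) of route `SAWDevelopingMap`. Every open stratum of
the crux reduces to ONE estimate: a uniform bound `< sin(π/8)` on the critical returning-loop series
`Z_Ω = G_Ω({v,w₁},{v,w₂})` of a simply connected domain `Ω = Λ ∖ {v}` (`u, w₁, w₂` the neighbours of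
`v`, `u ∉ Λ`). The only rigorous tool available for it is the vertex relation of Duminil-Copin–Smirnov
(Lemma 1); summed over the domain it gives, for EVERY boundary source `b`, the boundary identity
"`hexFlux Ω F_b = 0`" (`HexGreen.hexFlux`, the discrete contour integral of `F_b` around `Ω`; the
source term `F_b(b) = 1` included) among the boundary values `F_b(m) = bphase(b,m) · G(b,m)`, whose
PHASES ARE RIGID (`bphase`, `HexMidEdgeSAW.winding_eq_of_mem_boundary`) and whose moduli
`G(b,m) = Σ_{γ : b → m} x_c^{ℓ(γ)} ≥ 0` are the unknowns.

**Theorem `dcs_boundary_identities_admit_ray`.** There is a finite simply connected domain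
`Λ = rayDomain` (a lattice ball minus a spiral slit, 72 vertices) with the configuration
`(u, v, w₁, w₂)` of `SourceLoopBound`, and a NONNEGATIVE SYMMETRIC kernel `D = rayD` on pairs of
mid-edges with `D({v,w₁},{v,w₂}) = 1`, such that for every boundary mid-edge `b` of `Ω = Λ ∖ {v}` the
boundary flux of `m ↦ bphase(b,m) · D(b,m)` vanishes. Consequently
(**`dcs_boundary_data_unbounded`**) for every real `C` there are boundary data
`Φ_b = bphase(b, ·) · g(b, ·)` with `g ≥ 0`, `Φ_b(b) = 1`, satisfying EVERY boundary identity
`hexFlux Ω Φ_b = 0`, and with returning-loop modulus `g({v,w₁},{v,w₂}) > C`: no argument using only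
these identities, positivity and phase rigidity can bound the returning-loop series of `Ω` — in
particular not below `sin(π/8)`. (Numerically `Z_Ω = 0.068` for this domain; the all-source LP value
grows like `0.35·R` for straight slits of length `R` and equals `1/x_c` for the half-plane notch:
evidence `LP-BARRIER.md` on the crux item, with the exact certificate `cert_ball_p3_t125.json` from
which the kernel and the fourteen row identities of `BoundaryRayRows.lean` were generated.)

The construction: `BoundaryRayMkWalk` (explicit walks and their windings), `BoundaryRayDomain`
(the domain, simple connectivity), `BoundaryRayPhases*` (the 42 rigid phases), `BoundaryRayKernel`
(the kernel, positivity), `BoundaryRayFlux` (flux in coordinates, the algebra of `ℚ(ζ₄₈)`),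
`BoundaryRayValues`, `BoundaryRayRows` (the identities). Sources: H. Duminil-Copin, S. Smirnov,
Ann. of Math. 175 (2012), Lemma 1 and §3. Sorry-free; axioms `propext`, `Classical.choice`,
`Quot.sound`.
-/

noncomputable section

open Literature.Probability.LatticeModels Literature.Probability.RandomPlanarGeometry.SAW
open Literature.Barriers.CriticalPhenomena Literature.Barriers.CriticalPhenomena.HexKernel
  Literature.Barriers.CriticalPhenomena.HexGreen

namespace Summit.CriticalPhenomena.SAWScalingLimit.Theorems.NoFoldBound.Negative.BoundaryRay

-- the `decide`s below evaluate the 65-dart boundary finset of the 71-vertex domain `Ω`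
set_option maxRecDepth 100000

/-! ### Every boundary row: the fourteen nontrivial ones and the zero ones -/

/-- A key that is no component of any entry has an identically zero row. -/
theorem coefQ_eq_zero_of_forall_ne (p : ℤ × ℤ)
    (h : ∀ e ∈ rayEntries, (entryKeys e).1 ≠ p ∧ (entryKeys e).2 ≠ p) (q : ℤ × ℤ) : coefQ p q = 0 := by
  have hnone : rayEntries.find? (fun e => decide (entryKeys e = (p, q) ∨ entryKeys e = (q, p))) = none := by
    rw [List.find?_eq_none]
    intro e he
    obtain ⟨h1, h2⟩ := h e he
    simp only [decide_eq_true_eq, not_or]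
    exact ⟨fun heq => h1 (by rw [heq]), fun heq => h2 (by rw [heq])⟩
  unfold coefQ
  rw [hnone]

/-- Off the fourteen sources the key of the source is no component of any entry (decided on the
table), so its kernel row vanishes identically. -/
theorem keys_ne_of_notMem_touched :
    ∀ d ∈ bdarts, d ∉ touched → ∀ e ∈ rayEntries,
      (entryKeys e).1 ≠ ekeyHV d.2 d.1 ∧ (entryKeys e).2 ≠ ekeyHV d.2 d.1 := by
  decide

/-- **Every boundary row vanishes.** -/
theorem flux_of_dart : ∀ d ∈ bdarts,
    hexFlux rayOmega (fun m => bphase rayOmega s(ofHV d.2, ofHV d.1) m *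
      (rayD s(ofHV d.2, ofHV d.1) m : ℂ)) = 0 := by
  intro d hd
  by_cases ht : d ∈ touched
  · simp only [touched, Finset.mem_insert, Finset.mem_singleton] at ht
    rcases ht with rfl | rfl | rfl | rfl | rfl | rfl | rfl | rfl | rfl | rfl | rfl | rfl | rfl | rfl
    · exact flux_row_10
    · exact flux_row_16
    · exact flux_row_23
    · exact flux_row_24
    · exact flux_row_32
    · exact flux_row_33
    · exact flux_row_35
    · exact flux_row_40
    · exact flux_row_43
    · exact flux_row_49
    · exact flux_row_55
    · exact flux_row_56
    · exact flux_row_60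
    · exact flux_row_62
  · rw [flux_eq_sum_support d.2 d.1 ∅ (Finset.empty_subset _) (fun d' _ _ =>
      coefQ_eq_zero_of_forall_ne _ (keys_ne_of_notMem_touched d hd ht) _), Finset.sum_empty]

/-- A boundary mid-edge of `Ω` is `{o, y}` for a boundary dart `(y, o)` in coordinates. -/
theorem exists_dart_of_mem_boundary {b : Sym2 HexVertex} (hb : b ∈ hexDomainBoundary rayOmega) :
    ∃ d ∈ bdarts, b = s(ofHV d.2, ofHV d.1) := by
  obtain ⟨he, u, y, rfl, hy, hu⟩ := hb
  refine ⟨⟨toHV y, toHV u⟩, ?_, by simp⟩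
  have hadj : hexGraph.Adj y u :=
    ((SimpleGraph.mem_edgeSet hexGraph).1 he).symm
  rw [bdarts, Finset.mem_sigma]
  refine ⟨(mem_rayOmega_iff y).1 hy, ?_⟩
  rw [List.mem_toFinset, List.mem_filter]
  refine ⟨(hvGraph_adj_iff_mem_nbrs _ _).1 ((hexGraph_adj_iff_hvGraph_adj y u).1 hadj), ?_⟩
  simpa using fun h => hu ((mem_rayOmega_iff u).2 h)

/-- **Every DCS boundary identity of `Ω` is satisfied by `bphase · D`.** -/
theorem flux_bphase_mul_rayD_eq_zero {b : Sym2 HexVertex} (hb : b ∈ hexDomainBoundary rayOmega) :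
    hexFlux rayOmega (fun m => bphase rayOmega b m * (rayD b m : ℂ)) = 0 := by
  obtain ⟨d, hd, rfl⟩ := exists_dart_of_mem_boundary hb
  exact flux_of_dart d hd

/-! ### The ray -/

/-- **The Duminil-Copin–Smirnov boundary identities, with positivity and rigid phases, admit an
unbounded nonnegative solution.** There is a finite simply connected hexagonal domain `Λ` with the
configuration of `SourceLoopBound` (`u ∉ Λ ∋ v`, `u, w₁, w₂` the three neighbours of `v`) and a
nonnegative symmetric kernel `D` on pairs of mid-edges, equal to `1` on the returning-loop pair
`({v,w₁}, {v,w₂})`, such that for every boundary mid-edge `b` of `Ω = Λ ∖ {v}` the boundary flux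
(discrete contour integral around `Ω`) of `m ↦ e^{-i(5/8)W(b→m)} D(b,m)` vanishes. -/
theorem dcs_boundary_identities_admit_ray :
    ∃ (Λ : Finset HexVertex) (u v w₁ w₂ : HexVertex),
      hexDomainSimplyConnected Λ ∧ hexDomainSimplyConnected (Λ.erase v) ∧
      u ∉ Λ ∧ v ∈ Λ ∧ hexGraph.Adj v u ∧ hexGraph.Adj v w₁ ∧ hexGraph.Adj v w₂ ∧
      u ≠ w₁ ∧ u ≠ w₂ ∧ w₁ ≠ w₂ ∧
      ∃ D : Sym2 HexVertex → Sym2 HexVertex → ℝ,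
        (∀ b m, 0 ≤ D b m) ∧ (∀ b m, D b m = D m b) ∧ D s(v, w₁) s(v, w₂) = 1 ∧
        ∀ b ∈ hexDomainBoundary (Λ.erase v),
          hexFlux (Λ.erase v) (fun m => bphase (Λ.erase v) b m * (D b m : ℂ)) = 0 :=
  ⟨rayDomain, rayU, rayV, rayW₁, rayW₂, rayDomain_simplyConnected, rayOmega_simplyConnected,
    rayU_notMem, rayV_mem, adj_rayV_rayU, adj_rayV_rayW₁, adj_rayV_rayW₂, rayU_ne_rayW₁, rayU_ne_rayW₂,
    rayW₁_ne_rayW₂, rayD, rayD_nonneg, rayD_symm, rayD_target,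
    fun _ hb => flux_bphase_mul_rayD_eq_zero hb⟩

/-! ### Consequence: the boundary data of the observable are not bounded by the identities -/

/-- The boundary flux is additive in `F`. -/
theorem hexFlux_add (S : Finset HexVertex) (F G : Sym2 HexVertex → ℂ) :
    hexFlux S (F + G) = hexFlux S F + hexFlux S G := by
  simp only [hexFlux, term, Pi.add_apply, mul_add, Finset.sum_add_distrib]

/-- The boundary flux is homogeneous in `F`. -/
theorem hexFlux_smul (S : Finset HexVertex) (c : ℂ) (F : Sym2 HexVertex → ℂ) :
    hexFlux S (c • F) = c * hexFlux S F := by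
  simp only [hexFlux, term, Pi.smul_apply, smul_eq_mul, Finset.mul_sum]
  refine Finset.sum_congr rfl fun _ _ => Finset.sum_congr rfl fun _ _ => by ring

/-- The diagonal of the kernel vanishes on the boundary of `Ω` (decided on the table). -/
theorem rayD_self_of_mem_bdarts : ∀ d ∈ bdarts, coefQ (ekeyHV d.2 d.1) (ekeyHV d.2 d.1) = 0 := by
  decide

/-- **The observable of `Ω` satisfies every boundary identity** (Lemma 1 summed over the simply
connected domain `Ω`: the discrete Green identity `HexGreen.sum_relations_eq_hexFlux`). -/
theorem hexFlux_observable_eq_zero {b : Sym2 HexVertex} (hb : b ∈ hexDomainBoundary rayOmega) :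
    hexFlux rayOmega (hexParafermionicObservable rayOmega b hexCriticalFugacity (5 / 8)) = 0 := by
  refine hexFlux_eq_zero_of_satisfiesVertexRelations ?_
  have h := lemma1_iff.1 DuminilCopinSmirnov2012_lemma1_holds rayOmega rayOmega_simplyConnected b hb
  simpa [hexCriticalFugacity] using h

/-- **The barrier.** For every real `C` there are boundary data `Φ_b` (`b ∈ ∂Ω`) on the domain
`Ω = rayDomain ∖ {v}` that satisfy EVERY Duminil-Copin–Smirnov boundary identity `hexFlux Ω Φ_b = 0`,
have the RIGID PHASES with NONNEGATIVE moduli `Φ_b(m) = bphase(b,m) g(b,m)`, `g ≥ 0`, the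
normalisation `Φ_b(b) = 1`, and returning-loop modulus `g({v,w₁},{v,w₂}) > C`. (Take the true
observable plus `t` times the ray.) Hence these data cannot bound the returning-loop series
`Z_Ω = G_Ω({v,w₁},{v,w₂})` of `SourceLoopBound` — not below `sin(π/8)`, not at all. -/
theorem dcs_boundary_data_unbounded (C : ℝ) :
    ∃ (Φ : Sym2 HexVertex → Sym2 HexVertex → ℂ) (g : Sym2 HexVertex → Sym2 HexVertex → ℝ),
      (∀ b ∈ hexDomainBoundary rayOmega, hexFlux rayOmega (Φ b) = 0) ∧
      (∀ b ∈ hexDomainBoundary rayOmega, ∀ m ∈ hexDomainBoundary rayOmega,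
        Φ b m = bphase rayOmega b m * (g b m : ℂ) ∧ 0 ≤ g b m) ∧
      (∀ b ∈ hexDomainBoundary rayOmega, Φ b b = 1) ∧
      C < g s(rayV, rayW₁) s(rayV, rayW₂) := by
  set t : ℝ := max C 0 + 1 with ht
  have ht0 : 0 ≤ t := by rw [ht]; have := le_max_right C 0; linarith
  -- the moduli of the observable: the generating functions `G(b,m) = Σ x_c^ℓ`
  let G : Sym2 HexVertex → Sym2 HexVertex → ℝ := fun b m =>
    ∑ γ : HexMidEdgeSAW rayOmega b m, hexCriticalFugacity ^ γ.length
  refine ⟨fun b m => hexParafermionicObservable rayOmega b hexCriticalFugacity (5 / 8) m +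
      (t : ℂ) * (bphase rayOmega b m * (rayD b m : ℂ)),
    fun b m => G b m + t * rayD b m, ?_, ?_, ?_, ?_⟩
  · -- every identity: the observable's flux vanishes, and the ray's
    intro b hb
    have e : (fun m => hexParafermionicObservable rayOmega b hexCriticalFugacity (5 / 8) m +
        (t : ℂ) * (bphase rayOmega b m * (rayD b m : ℂ))) =
        hexParafermionicObservable rayOmega b hexCriticalFugacity (5 / 8) +
          (t : ℂ) • fun m => bphase rayOmega b m * (rayD b m : ℂ) := by
      funext m; simp
    show hexFlux rayOmega (fun m => hexParafermionicObservable rayOmega b hexCriticalFugacity (5 / 8) m +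
        (t : ℂ) * (bphase rayOmega b m * (rayD b m : ℂ))) = 0
    rw [e, hexFlux_add, hexFlux_smul, hexFlux_observable_eq_zero hb, flux_bphase_mul_rayD_eq_zero hb]
    simp
  · -- rigid phases and nonnegative moduli
    intro b hb m hm
    constructor
    · show hexParafermionicObservable rayOmega b hexCriticalFugacity (5 / 8) m +
          (t : ℂ) * (bphase rayOmega b m * (rayD b m : ℂ)) =
        bphase rayOmega b m * ((G b m + t * rayD b m : ℝ) : ℂ)
      rw [hexParafermionicObservable_def]
      have hw : ∀ γ : HexMidEdgeSAW rayOmega b m, γ.weight hexCriticalFugacity (5 / 8) =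
          bphase rayOmega b m * ((hexCriticalFugacity : ℂ) ^ γ.length) :=
        fun γ => weight_eq_bphase_mul rayOmega_simplyConnected hb hm γ hexCriticalFugacity
      simp only [hw, ← Finset.mul_sum]
      have hG : ((G b m : ℝ) : ℂ) = ∑ γ : HexMidEdgeSAW rayOmega b m, (hexCriticalFugacity : ℂ) ^ γ.length := by
        push_cast [G]; rfl
      push_cast
      rw [hG]
      ring
    · show 0 ≤ G b m + t * rayD b m
      have hx : 0 ≤ hexCriticalFugacity := hexCriticalFugacity_pos_lt_one.1.le
      exact add_nonneg (Finset.sum_nonneg fun γ _ => pow_nonneg hx _)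
        (mul_nonneg ht0 (rayD_nonneg b m))
  · -- normalisation `Φ_b(b) = 1`: the trivial walk, and the diagonal of the kernel is zero
    intro b hb
    obtain ⟨d, hd, rfl⟩ := exists_dart_of_mem_boundary hb
    have h0 : rayD s(ofHV d.2, ofHV d.1) s(ofHV d.2, ofHV d.1) = 0 := by
      rw [rayD, ekey_mk]; simp only [toHV_ofHV]
      unfold ekeyHV
      have := rayD_self_of_mem_bdarts d hd
      unfold ekeyHV at this
      rw [this]; simp [evalT]
    show hexParafermionicObservable rayOmega s(ofHV d.2, ofHV d.1) hexCriticalFugacity (5 / 8)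
        s(ofHV d.2, ofHV d.1) + (t : ℂ) * (bphase rayOmega s(ofHV d.2, ofHV d.1) s(ofHV d.2, ofHV d.1) *
          (rayD s(ofHV d.2, ofHV d.1) s(ofHV d.2, ofHV d.1) : ℂ)) = 1
    rw [hexParafermionicObservable_self hb, h0]
    simp
  · -- the returning-loop modulus
    show C < G s(rayV, rayW₁) s(rayV, rayW₂) + t * rayD s(rayV, rayW₁) s(rayV, rayW₂)
    rw [rayD_target, mul_one]
    have hG : 0 ≤ G s(rayV, rayW₁) s(rayV, rayW₂) :=
      Finset.sum_nonneg fun γ _ => pow_nonneg hexCriticalFugacity_pos_lt_one.1.le _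
    have : C < t := by rw [ht]; have := le_max_left C 0; linarith
    linarith

end Summit.CriticalPhenomena.SAWScalingLimit.Theorems.NoFoldBound.Negative.BoundaryRay
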